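import Summits.PneNP.PneNP.Theses.BorrowedMemory
import Literature.Computability.Complexity.CatalyticSpace
import Literature.Computability.Complexity.CookBridges
import Literature.Computability.Complexity.CatalyticSpaceLogspace

/-!
# STRATEGY-CENSUS support — route BorrowedMemory modulo `CL ⊆ P`

Kernel-checked bookkeeping for the redirect strategist pass `cstrat-stmt-PneNP-18880-r1`
(crux `PolyTimeIsCatalytic`, item stmt-PneNP-18880).  Nothing here is deep; the point is to
make the census's structural claims about the route checkable:

* `polyTimeIsCatalytic_iff` : the crux is literally `P ⊆ CL`;
* `npNotCatalytic_iff`      : the sibling crux is literally `¬ (NP ⊆ CL)`;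
* `npNotCatalytic_of_pneNP` : under `CL ⊆ P` the lower-bound crux is a COROLLARY of the summit;
* `route_iff_summit_and_crux` : under `CL ⊆ P`,
    `PolyTimeIsCatalytic ∧ NPNotCatalytic ↔ PolyTimeIsCatalytic ∧ PneNP`
  — i.e. modulo the believed inclusion `CL ⊆ P` (a consequence of `CL ⊆ ZPP` [BCKLS14] and
  `ZPP = P`), the route's conjunction is the summit PLUS the extra inclusion `P ⊆ CL`;
* `CL_subset_P_of_ZPP_subset_P` : `CL ⊆ P` from the named fact `BCKLS2014_CL_subset_ZPP` and
  the derandomisation hypothesis `ZPP ⊆ P`;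
* `polyTimeIsCatalytic_iff_eq` : under `CL ⊆ P` the crux is the class equality `P = CL`;
* `P_not_subset_LOGSPACE_of_not` : NEGATION side — refuting the crux (`P ⊄ CL`) proves
  `P ⊄ LOGSPACE`, i.e. `L ≠ P`, via the tree's proved rung `LOGSPACE_subset_CL`;
* `route_support_rung` : the tree's proved first rung `LOGSPACE ⊆ CL`, re-exported by name.

No `sorry`; hypotheses are explicit binders (no axioms).
-/

set_option linter.dupNamespace false

namespace Summit.PneNP.PneNP.Cruxes.PolyTimeIsCatalytic.Census

open Literature.Computability.Complexity
open Literature.PNP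
open Summit.PneNP.PneNP.Theses.BorrowedMemory

/-- The deciding crux is the class inclusion `P ⊆ CL` (definitional). -/
theorem polyTimeIsCatalytic_iff : PolyTimeIsCatalytic ↔ PNPWave0.P Bool ⊆ CL := Iff.rfl

/-- The sibling crux is `NP ⊄ CL` in witness form (definitional). -/
theorem npNotCatalytic_iff :
    NPNotCatalytic ↔ ∃ L : Language Bool, L ∈ PNPWave0.NP Bool ∧ L ∉ CL := Iff.rfl

/-- `NP ⊄ CL` as a non-inclusion. -/
theorem npNotCatalytic_iff_not_subset : NPNotCatalytic ↔ ¬ (PNPWave0.NP Bool ⊆ CL) := by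
  rw [npNotCatalytic_iff, Set.not_subset]

/-- Under `CL ⊆ P`, the lower-bound crux `NPNotCatalytic` is a consequence of the summit. -/
theorem npNotCatalytic_of_pneNP (hCP : CL ⊆ PNPWave0.P Bool) (hS : PneNP) : NPNotCatalytic := by
  obtain ⟨L, hNP, hP⟩ := hS
  exact ⟨L, hNP, fun hCL => hP (hCP hCL)⟩

/-- Under `CL ⊆ P`, the route's conjunction of cruxes is equivalent to the summit together with
the extra inclusion `P ⊆ CL`: the route is `S ∧ (P ⊆ CL)` in these terms. -/
theorem route_iff_summit_and_crux (hCP : CL ⊆ PNPWave0.P Bool) :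
    (PolyTimeIsCatalytic ∧ NPNotCatalytic) ↔ (PolyTimeIsCatalytic ∧ PneNP) :=
  ⟨fun h => ⟨h.1, closes h.1 h.2⟩, fun h => ⟨h.1, npNotCatalytic_of_pneNP hCP h.2⟩⟩

/-- Under `CL ⊆ P` and the simulation crux, the lower-bound crux is EQUIVALENT to the summit. -/
theorem npNotCatalytic_iff_pneNP (hCP : CL ⊆ PNPWave0.P Bool) (h₁ : PolyTimeIsCatalytic) :
    NPNotCatalytic ↔ PneNP :=
  ⟨fun h₂ => closes h₁ h₂, npNotCatalytic_of_pneNP hCP⟩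

/-- `CL ⊆ P` from `CL ⊆ ZPP` (BCKLS 2014, named fact) and `ZPP ⊆ P` (derandomisation,
e.g. a consequence of `BPP = P`). -/
theorem CL_subset_P_of_ZPP_subset_P (hZ : BCKLS2014_CL_subset_ZPP) (hZP : ZPP ⊆ Classes.P) :
    CL ⊆ PNPWave0.P Bool := by
  rw [p_bool_eq]
  exact hZ.trans hZP

/-- Under `CL ⊆ P` the simulation crux is the class equality `P = CL`. -/
theorem polyTimeIsCatalytic_iff_eq (hCP : CL ⊆ PNPWave0.P Bool) :
    PolyTimeIsCatalytic ↔ PNPWave0.P Bool = CL :=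
  ⟨fun h => Set.Subset.antisymm h hCP, fun h => h.le⟩

-- (Unconditionally `PolyTimeIsCatalytic → NPNotCatalytic → PneNP` is the route's own `closes`; not restated here.)

/-- Unconditionally: `NP ⊄ CL` implies `NP ⊄ L`-type consequences only through `L ⊆ CL`; recorded
here is the trivial monotonicity used in the census (`A ⊆ CL → NP ⊄ CL → NP ⊄ A`). -/
theorem not_NP_subset_of_subset_CL {A : Set (Language Bool)} (hA : A ⊆ CL) (h : NPNotCatalytic) :
    ¬ (PNPWave0.NP Bool ⊆ A) := by
  obtain ⟨L, hNP, hCL⟩ := h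
  exact fun hsub => hCL (hA (hsub hNP))

/-- NEGATION: a refutation of the crux (`¬ (P ⊆ CL)`) yields `P ⊄ LOGSPACE` (so `LOGSPACE ≠ P`), by
the tree's proved rung `LOGSPACE ⊆ CL` (`CatalyticSpaceLogspace.lean`). Hence the negation line is
at least as hard as separating `L` from `P`. -/
theorem P_not_subset_LOGSPACE_of_not (h : ¬ PolyTimeIsCatalytic) :
    ¬ (PNPWave0.P Bool ⊆ LOGSPACE) :=
  fun hPL => h (fun _ hL => LOGSPACE_subset_CL (hPL hL))

/-- Same, as a class inequality. -/
theorem LOGSPACE_ne_P_of_not (h : ¬ PolyTimeIsCatalytic) : LOGSPACE ≠ PNPWave0.P Bool :=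
  fun hEq => P_not_subset_LOGSPACE_of_not h (fun _ hL => by rw [← hEq] at hL; exact hL)

/-- The first rung of the crux's ladder, proved in the tree: `LOGSPACE ⊆ CL`. -/
theorem route_support_rung : LOGSPACE ⊆ CL := LOGSPACE_subset_CL

end Summit.PneNP.PneNP.Cruxes.PolyTimeIsCatalytic.Census
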